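import Summits.HubbardSuperconductivity.HubbardLadder.Bounds.ComplexTwistActivity
import Mathlib.Analysis.Complex.Liouville
import Mathlib.Analysis.Complex.RealDeriv
import Mathlib.Analysis.Complex.ExponentialBounds
import Mathlib.Analysis.Calculus.IteratedDeriv.Lemmas
import HarnessLib

/-!
# Theorem 12 (iii): the curvature — all twist derivatives of `log Z_L` are exponentially small at
# high temperature, uniformly in the on-site interaction (LEAN FILING REQUEST #206.3, bounds g27)

HONEST FRAMING (cell pub-hubbard): ladder R1–R4 with certified numbers; no claim on H/H₀. This file
is a BOUND FOR A MODEL CLASS (the seam-twisted `t–t'` Hubbard torus `hubbardTorusTT'FluxMu L t' U μ θ`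
at high temperature, any sign of `U`, any `μ`); no materials claim.

bounds.tex Theorem 12 (iii): under KP(a,b;η) with `η > 0`,
`|∂_A^k log Z_L(β,0)| ≤ 2 k! a L² e^{-bL} η^{-k}` for all `k ≥ 1`, in particular the thermal twist
curvature `𝒟^F(β) = L⁻² ∂_A² F(β,0)`, `F = -β⁻¹ log Z_L`, obeys `|𝒟^F(β)| ≤ 4a e^{-bL}/(β η²)`.
Here `A` is the uniform vector potential; in the tree's seam variable `θ = AL` (`∂_A = L ∂_θ`) the
statement reads `|f^{(k)}(0)| ≤ 2 k! a L² e^{-bL} (Lη)^{-k}`, `f(θ) = log Re Z_L(θ)`,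
`Z_L(θ) = Tr e^{-β H_θ}`, `H_θ = hubbardTorusTT'FluxMu L t' U μ θ` — this is the node
`HighTemperatureTwistCurvatureTT'` below, PROVED (`highTemperatureTwistCurvatureTT'_holds`), with the
paper's hypothesis in the majorant form `KP̄(β(1+|t'|); a, b, η)`, i.e.
`kpBarLHS (β e^{η} (1+|t'|)) a b ≤ a` (#181.1's `kpBarLHS`; `|t| = 1`).

Proof (bounds.tex, proof of Thm 12 (iii)): the Kotecký–Preiss logarithm
`F(θ) = log Ξ(ρ_θ) - log Ξ(ρ_0)` of the polymer gas of the torus twisted by a COMPLEX seam angle is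
holomorphic on the strip `|Im θ| < Lη`, continuous and bounded by `2a L² e^{-δL}` on the closed strip
(`ComplexTwistActivity`, spreading gauge of `ComplexSeamGauge`), and agrees with `f(θ) - f(0)` on the
real axis (#196's `re_polymerLogZ_sub_eq_log_sub_of_isSmallActivityA`); Cauchy's estimate on the disc
of radius `Lη` (Mathlib `Complex.norm_iteratedDeriv_le_of_forall_mem_sphere_norm_le`) bounds
`F^{(k)}(0)`, and the real derivatives of `f` are the real parts of those of `F`
(`HasDerivAt.real_of_complex`).

* `HighTemperatureTwistCurvatureTT'` + `_holds` — Thm 12 (iii), all `k ≥ 1`. PROVED.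
* `thermalTwistCurvature L t' U μ β := -f''(0)/β = 𝒟^F_L(β)`; `HighTemperatureNoTwistCurvatureTT'`
  + `_holds` — `|𝒟^F| ≤ 4a e^{-bL}/(β η²)`. PROVED.
* `HighTemperatureNoTwistCurvatureTT'At265` + `_holds` — the certified instance
  `KP̄(1/265; 0.377, 10⁻³, 1/2)` of Thm 12 (iv): `T ≥ 265(|t|+|t'|) ⇒ |𝒟^F| ≤ 6.032 T e^{-L/1000}`
  (paper: `6.04 T e^{-L/1000}`), via `e^{1/2} ≤ 265/160`, #181.1's `kpBarLHS_mono` and the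
  kernel-certified `kpBarLHS_inst160`. PROVED.

References: D. Ueltschi, J. Stat. Phys. 95 (1999) 693, §2.3, Prop. 2.2 [Ueltschi1999]; R. Kotecký,
D. Preiss, Comm. Math. Phys. 103 (1986) 491 [KoteckyPreiss1986]; bounds.tex §12 Thm 12 (iii)–(iv),
EXTREMISERS.md §5w.
-/

noncomputable section

namespace Summit.HubbardSuperconductivity.HubbardLadder.Bounds

open Matrix Finset Metric Literature.MathematicalPhysics.QuantumLattice Literature.Probability.LatticeModels
open scoped ComplexConjugate ComplexOrder Topology Nat

/-! ### Real parts of complex derivatives along the real axis -/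

/-- **Real derivatives of the real part of a holomorphic function along the real axis**: if `F` is
holomorphic on an open set containing the real axis, then for every `k` the `k`-th derivative of
`x ↦ Re F(x)` (`x` real) is `Re F^{(k)}(x)`. [folklore; Mathlib `HasDerivAt.real_of_complex`] -/
theorem iteratedDeriv_re_comp_ofReal {F : ℂ → ℂ} {S : Set ℂ} (hS : IsOpen S)
    (hF : DifferentiableOn ℂ F S) (hreal : ∀ x : ℝ, (x : ℂ) ∈ S) (k : ℕ) (x : ℝ) :
    iteratedDeriv k (fun y : ℝ => (F y).re) x = (iteratedDeriv k F x).re := by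
  have hA : AnalyticOnNhd ℂ F S := hF.analyticOnNhd hS
  induction k generalizing x with
  | zero => simp
  | succ k ih =>
    rw [iteratedDeriv_succ, iteratedDeriv_succ]
    have hk : AnalyticOnNhd ℂ (iteratedDeriv k F) S := by
      rw [iteratedDeriv_eq_iterate]
      exact hA.iterated_deriv k
    have hfun : iteratedDeriv k (fun y : ℝ => (F y).re) = fun y : ℝ => (iteratedDeriv k F y).re :=
      funext ih
    rw [hfun]
    have hd : HasDerivAt (iteratedDeriv k F) (deriv (iteratedDeriv k F) x) x :=
      (hk x (hreal x)).differentiableAt.hasDerivAt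
    exact hd.real_of_complex.deriv

section Torus

open Literature.MathematicalPhysics.QuantumFieldTheory

variable {L : ℕ} [NeZero L]

/-! ### The Kotecký–Preiss free-energy difference as a function of the complex twist -/

/-- **The complex free-energy difference** `F(θ) := log Ξ(ρ_θ) - log Ξ(ρ_0)` (Kotecký–Preiss
logarithms of the polymer gases of the torus twisted by the complex seam angle `θ` and untwisted).
[programme definition: bounds.tex §12, proof of Thm 12 (iii)] -/
def twistLogZC (L : ℕ) [NeZero L] (β t' U μ : ℝ) (θ : ℂ) : ℂ :=
  polymerLogZ polyInc (ttActivityC L β t' U μ θ) (Finset.univ : Finset (FermionTorus 2 L)).powerset -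
    polymerLogZ polyInc (ttActivity L β t' U μ 0) (Finset.univ : Finset (FermionTorus 2 L)).powerset

/-- **Bound on the closed strip**: `‖F(θ)‖ ≤ 2a L² e^{-δL}` for `|Im θ| ≤ Lη`. [programme:
bounds.tex §12, (12.2) for complex twists] -/
theorem norm_twistLogZC_le (hL : 3 ≤ L) (β t' U μ : ℝ) (θ : ℂ) {η s a δ : ℝ} (hη : |θ.im| ≤ L * η)
    (hs : |β| * (1 + |t'|) * Real.exp η ≤ s) (ha : 0 < a) (hδ : 0 < δ)
    (hsmall : 16 * s * Real.exp (2 * s) * (Real.exp (a + δ) + a) ^ 2 ≤ a) :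
    ‖twistLogZC L β t' U μ θ‖ ≤ 2 * a * (L : ℝ) ^ 2 * Real.exp (-(δ * L)) :=
  norm_polymerLogZ_ttActivityC_sub_le hL β t' U μ θ hη hs ha hδ hsmall

/-- **Holomorphy** of `F` on the open strip `|Im θ| < Lη`. [this file, from `ComplexTwistActivity`] -/
theorem differentiableOn_twistLogZC (hL : 3 ≤ L) (β t' U μ : ℝ) {η s a δ : ℝ}
    (hs : |β| * (1 + |t'|) * Real.exp η ≤ s) (ha : 0 < a) (hδ : 0 < δ)
    (hsmall : 16 * s * Real.exp (2 * s) * (Real.exp (a + δ) + a) ^ 2 ≤ a) :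
    DifferentiableOn ℂ (twistLogZC L β t' U μ) (twistStrip L η) :=
  (differentiableOn_polymerLogZ_ttActivityC hL β t' U μ hs ha hδ hsmall).sub_const _

/-- **Continuity** of `F` on the closed strip `|Im θ| ≤ Lη`. [this file, from `ComplexTwistActivity`] -/
theorem continuousOn_twistLogZC (hL : 3 ≤ L) (β t' U μ : ℝ) {η s a δ : ℝ}
    (hs : |β| * (1 + |t'|) * Real.exp η ≤ s) (ha : 0 < a) (hδ : 0 < δ)
    (hsmall : 16 * s * Real.exp (2 * s) * (Real.exp (a + δ) + a) ^ 2 ≤ a) :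
    ContinuousOn (twistLogZC L β t' U μ) (twistStripClosed L η) :=
  (continuousOn_polymerLogZ_ttActivityC hL β t' U μ hs ha hδ hsmall).sub continuousOn_const

/-- `F` is holomorphic on the disc `|θ| < Lη` and continuous on its closure (the disc lies in the
strip). [this file] -/
theorem diffContOnCl_twistLogZC (hL : 3 ≤ L) (β t' U μ : ℝ) {η s a δ : ℝ}
    (hs : |β| * (1 + |t'|) * Real.exp η ≤ s) (ha : 0 < a) (hδ : 0 < δ)
    (hsmall : 16 * s * Real.exp (2 * s) * (Real.exp (a + δ) + a) ^ 2 ≤ a) :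
    DiffContOnCl ℂ (twistLogZC L β t' U μ) (ball (0 : ℂ) (L * η)) := by
  refine DiffContOnCl.mk_ball ?_ ?_
  · refine (differentiableOn_twistLogZC hL β t' U μ hs ha hδ hsmall).mono fun θ hθ => ?_
    rw [mem_ball_zero_iff] at hθ
    exact mem_twistStrip.2 ((Complex.abs_im_le_norm θ).trans_lt hθ)
  · refine (continuousOn_twistLogZC hL β t' U μ hs ha hδ hsmall).mono fun θ hθ => ?_
    rw [mem_closedBall_zero_iff] at hθ
    exact mem_twistStripClosed.2 ((Complex.abs_im_le_norm θ).trans hθ)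

/-- **Cauchy's estimate for the twist derivatives** (complex side): for `η > 0` and every `k`,
`‖F^{(k)}(0)‖ ≤ k! · 2a L² e^{-δL} / (Lη)^k`. [this file; bounds.tex §12, proof of Thm 12 (iii)] -/
theorem norm_iteratedDeriv_twistLogZC_le (hL : 3 ≤ L) (β t' U μ : ℝ) {η s a δ : ℝ} (hη : 0 < η)
    (hs : |β| * (1 + |t'|) * Real.exp η ≤ s) (ha : 0 < a) (hδ : 0 < δ)
    (hsmall : 16 * s * Real.exp (2 * s) * (Real.exp (a + δ) + a) ^ 2 ≤ a) (k : ℕ) :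
    ‖iteratedDeriv k (twistLogZC L β t' U μ) 0‖ ≤
      k ! * (2 * a * (L : ℝ) ^ 2 * Real.exp (-(δ * L))) / ((L : ℝ) * η) ^ k := by
  have hL0 : (0 : ℝ) < L := by exact_mod_cast (show 0 < L by omega)
  refine Complex.norm_iteratedDeriv_le_of_forall_mem_sphere_norm_le k (mul_pos hL0 hη)
    (diffContOnCl_twistLogZC hL β t' U μ hs ha hδ hsmall) fun z hz => ?_
  rw [mem_sphere_zero_iff_norm] at hz
  exact norm_twistLogZC_le hL β t' U μ z ((Complex.abs_im_le_norm z).trans hz.le) hs ha hδ hsmall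

/-- **On the real axis `Re F` is the free-energy difference**: for real `x`,
`Re F(x) = log Re Z_L(x) - log Re Z_L(0)`. [this file, from #196's
`re_polymerLogZ_sub_eq_log_sub_of_isSmallActivityA`] -/
theorem re_twistLogZC_ofReal (hL : 3 ≤ L) (β t' U μ : ℝ) {η s a δ : ℝ} (hη : 0 ≤ η)
    (hs : |β| * (1 + |t'|) * Real.exp η ≤ s) (ha : 0 < a) (hδ : 0 < δ)
    (hsmall : 16 * s * Real.exp (2 * s) * (Real.exp (a + δ) + a) ^ 2 ≤ a) (x : ℝ) :
    (twistLogZC L β t' U μ (x : ℂ)).re =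
      Real.log (partitionFn β (hubbardTorusTT'FluxMu L t' U μ x)).re -
        Real.log (partitionFn β (hubbardTorusTT'FluxMu L t' U μ 0)).re := by
  have hx : IsSmallActivityA (ttActivity L β t' U μ x) a δ := by
    have h := isSmallActivityA_ttActivityC hL β t' U μ (x : ℂ) (η := η)
      (by rw [Complex.ofReal_im, abs_zero]; positivity) hs ha hδ hsmall
    rwa [ttActivityC_ofReal hL] at h
  have h0 := isSmallActivityA_ttActivity_zero_of_strip hL β t' U μ hη hs ha hδ hsmall
  rw [twistLogZC, ttActivityC_ofReal hL]
  exact re_polymerLogZ_sub_eq_log_sub_of_isSmallActivityA hL β t' U μ x hx h0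

/-- **The real twist derivatives are the real parts of the complex ones**: for every `k` and real `x`,
`(d/dx)^k Re F(x) = Re F^{(k)}(x)`. [this file] -/
theorem iteratedDeriv_re_twistLogZC (hL : 3 ≤ L) (β t' U μ : ℝ) {η s a δ : ℝ} (hη : 0 < η)
    (hs : |β| * (1 + |t'|) * Real.exp η ≤ s) (ha : 0 < a) (hδ : 0 < δ)
    (hsmall : 16 * s * Real.exp (2 * s) * (Real.exp (a + δ) + a) ^ 2 ≤ a) (k : ℕ) (x : ℝ) :
    iteratedDeriv k (fun y : ℝ => (twistLogZC L β t' U μ y).re) x =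
      (iteratedDeriv k (twistLogZC L β t' U μ) x).re := by
  have hL0 : (0 : ℝ) < L := by exact_mod_cast (show 0 < L by omega)
  refine iteratedDeriv_re_comp_ofReal (isOpen_twistStrip (L := L) η)
    (differentiableOn_twistLogZC hL β t' U μ hs ha hδ hsmall) (fun y => ?_) k x
  rw [mem_twistStrip, Complex.ofReal_im, abs_zero]
  positivity

/-- **THEOREM (Thm 12 (iii), Hölder form).** For `L ≥ 3`, real `t', U, μ, β`, `η > 0`,
`|β|(1+|t'|) e^{η} ≤ s`, `a, δ > 0` with `16 s e^{2s} (e^{a+δ}+a)² ≤ a`, and every `k ≥ 1`: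
`|f^{(k)}(0)| ≤ 2a L² e^{-δL} k! / (Lη)^k`, `f(θ) = log Re Z_L(θ)`. [this file] -/
theorem abs_iteratedDeriv_log_partitionFn_le (hL : 3 ≤ L) (t' U μ β : ℝ) {η s a δ : ℝ} (hη : 0 < η)
    (hs : |β| * (1 + |t'|) * Real.exp η ≤ s) (ha : 0 < a) (hδ : 0 < δ)
    (hsmall : 16 * s * Real.exp (2 * s) * (Real.exp (a + δ) + a) ^ 2 ≤ a) {k : ℕ} (hk : 1 ≤ k) :
    |iteratedDeriv k (fun θ : ℝ => Real.log (partitionFn β (hubbardTorusTT'FluxMu L t' U μ θ)).re) 0| ≤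
      2 * a * (L : ℝ) ^ 2 * Real.exp (-(δ * L)) * k ! / ((L : ℝ) * η) ^ k := by
  have hf : (fun θ : ℝ => Real.log (partitionFn β (hubbardTorusTT'FluxMu L t' U μ θ)).re) =
      fun θ : ℝ => Real.log (partitionFn β (hubbardTorusTT'FluxMu L t' U μ 0)).re +
        (twistLogZC L β t' U μ θ).re := by
    funext θ
    rw [re_twistLogZC_ofReal hL β t' U μ hη.le hs ha hδ hsmall θ]
    ring
  rw [hf, iteratedDeriv_const_add hk, iteratedDeriv_re_twistLogZC hL β t' U μ hη hs ha hδ hsmall k 0,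
    Complex.ofReal_zero]
  refine (Complex.abs_re_le_norm _).trans
    ((norm_iteratedDeriv_twistLogZC_le hL β t' U μ hη hs ha hδ hsmall k).trans (le_of_eq ?_))
  ring

/-! ### The nodes: Theorem 12 (iii) and the curvature `𝒟^F` -/

/-- **Node (bounds.tex Thm 12 (iii); PROVED below).** For `L ≥ 3`, real `t', U, μ`, `β > 0`,
`a > 0`, `b ≥ 0`, `η > 0` with `KP̄(β(1+|t'|); a, b, η)`, i.e. `kpBarLHS (β e^{η} (1+|t'|)) a b ≤ a`
(the paper's KP(a,b;η) in majorant form, `|t| = 1`), and every `k ≥ 1`: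
`|f^{(k)}(0)| ≤ 2a L² e^{-bL} k!/(Lη)^k` for `f(θ) = log Re Tr e^{-β H_θ}`,
`H_θ = hubbardTorusTT'FluxMu L t' U μ θ` (seam variable; in the uniform vector potential `A = θ/L`
this is the paper's `|∂_A^k log Z_L(β,0)| ≤ 2 k! a L² e^{-bL} η^{-k}`), uniformly in `U`, `μ`.
[programme node: bounds.tex §12 Thm 12 (iii)] -/
@[conjecture] def HighTemperatureTwistCurvatureTT' : Prop :=
  ∀ (L : ℕ) [NeZero L], 3 ≤ L → ∀ (t' U μ β a b η : ℝ), 0 < β → 0 < a → 0 ≤ b → 0 < η →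
    kpBarLHS (β * Real.exp η * (1 + |t'|)) a b ≤ a →
    ∀ k : ℕ, 1 ≤ k →
      |iteratedDeriv k (fun θ : ℝ => Real.log (partitionFn β (hubbardTorusTT'FluxMu L t' U μ θ)).re) 0| ≤
        2 * a * (L : ℝ) ^ 2 * Real.exp (-(b * L)) * k ! / ((L : ℝ) * η) ^ k

/-- **PROOF of the node `HighTemperatureTwistCurvatureTT'`** (bounds.tex Thm 12 (iii)): Hölder form
with `s = β e^{η}(1+|t'|)`, `δ = b + 8s ≥ b` (#198.4's `kpExp_of_kpBarLHS`). [this file] -/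
theorem highTemperatureTwistCurvatureTT'_holds : HighTemperatureTwistCurvatureTT' := by
  intro L _ hL t' U μ β a b η hβ ha hb hη hkp k hk
  have hL0 : (0 : ℝ) < L := by exact_mod_cast (show 0 < L by omega)
  have hβ' : 0 < β * Real.exp η := mul_pos hβ (Real.exp_pos η)
  have hsmall := kpExp_of_kpBarLHS (t' := t') hβ' hkp
  have hs : |β| * (1 + |t'|) * Real.exp η ≤ |β * Real.exp η| * (1 + |t'|) :=
    le_of_eq (by rw [abs_mul, abs_of_pos (Real.exp_pos η)]; ring)
  have hy : 0 < β * Real.exp η * (1 + |t'|) := by positivity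
  have hδ : 0 < b + 8 * (β * Real.exp η * (1 + |t'|)) := by positivity
  refine (abs_iteratedDeriv_log_partitionFn_le hL t' U μ β hη hs ha hδ hsmall hk).trans ?_
  refine div_le_div_of_nonneg_right ?_ (pow_pos (mul_pos hL0 hη) k).le
  refine mul_le_mul_of_nonneg_right (mul_le_mul_of_nonneg_left (Real.exp_le_exp.2 ?_)
    (by positivity)) (Nat.cast_nonneg _)
  nlinarith [hy, hL0.le]

/-- **The thermal twist curvature** `𝒟^F_L(β) := L⁻² ∂_A² F(β,A)|_{A=0} = -f''(0)/β`, where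
`F = -β⁻¹ log Z_L`, `A = θ/L` is the uniform vector potential and `f(θ) = log Re Z_L(θ)` the free
energy in the seam variable (BOUNDS.md §0 conventions). [programme definition: bounds.tex §2
Definition (stiffness functionals), §12 Thm 12 (iii)] -/
def thermalTwistCurvature (L : ℕ) [NeZero L] (t' U μ β : ℝ) : ℝ :=
  -(iteratedDeriv 2 (fun θ : ℝ => Real.log (partitionFn β (hubbardTorusTT'FluxMu L t' U μ θ)).re) 0) / β

/-- **Node (bounds.tex Thm 12 (iii), the curvature; PROVED below).** Under the hypotheses of
`HighTemperatureTwistCurvatureTT'`: `|𝒟^F_L(β)| ≤ 4a e^{-bL}/(β η²)`, uniformly in `U`, `μ`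
(→ 0 exponentially in `L` whenever `b > 0`). [programme node: bounds.tex §12 Thm 12 (iii)] -/
@[conjecture] def HighTemperatureNoTwistCurvatureTT' : Prop :=
  ∀ (L : ℕ) [NeZero L], 3 ≤ L → ∀ (t' U μ β a b η : ℝ), 0 < β → 0 < a → 0 ≤ b → 0 < η →
    kpBarLHS (β * Real.exp η * (1 + |t'|)) a b ≤ a →
      |thermalTwistCurvature L t' U μ β| ≤ 4 * a * Real.exp (-(b * L)) / (β * η ^ 2)

/-- **PROOF of the node `HighTemperatureNoTwistCurvatureTT'`** (`k = 2` in Thm 12 (iii)). [this file] -/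
theorem highTemperatureNoTwistCurvatureTT'_holds : HighTemperatureNoTwistCurvatureTT' := by
  intro L _ hL t' U μ β a b η hβ ha hb hη hkp
  have hL0 : (0 : ℝ) < L := by exact_mod_cast (show 0 < L by omega)
  have h2 := highTemperatureTwistCurvatureTT'_holds L hL t' U μ β a b η hβ ha hb hη hkp 2 (by norm_num)
  rw [thermalTwistCurvature, abs_div, abs_neg, abs_of_pos hβ, div_le_div_iff₀ hβ (by positivity)]
  have hLne : (L : ℝ) ≠ 0 := hL0.ne'
  have hηne : η ≠ 0 := hη.ne'
  have hfac : ((2 : ℕ) ! : ℝ) = 2 := by norm_num [Nat.factorial]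
  rw [hfac] at h2
  calc |iteratedDeriv 2 (fun θ : ℝ => Real.log (partitionFn β (hubbardTorusTT'FluxMu L t' U μ θ)).re) 0| *
        (β * η ^ 2)
      ≤ 2 * a * (L : ℝ) ^ 2 * Real.exp (-(b * L)) * 2 / ((L : ℝ) * η) ^ 2 * (β * η ^ 2) :=
        mul_le_mul_of_nonneg_right h2 (by positivity)
    _ = 4 * a * Real.exp (-(b * L)) * β := by
        field_simp
        ring

/-! ### The certified instance `T ≥ 265(|t|+|t'|)` (`a = 0.377`, `b = 10⁻³`, `η = 1/2`) -/

/-- `e^{1/2} ≤ 265/160` (`e < 2.7182818286 < (265/160)² = 2.743…`). [this file] -/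
theorem exp_half_le_265 : Real.exp (1 / 2) ≤ 265 / 160 := by
  have h : Real.exp (1 / 2) * Real.exp (1 / 2) = Real.exp 1 := by
    rw [← Real.exp_add]; norm_num
  nlinarith [Real.exp_one_lt_d9, Real.exp_pos (1 / 2)]

/-- **Node (certified reading `T ≥ 265(|t|+|t'|)` of Thm 12 (iii)/(iv); PROVED below).** For `L ≥ 3`,
real `t', U, μ`, `β > 0` with `β(1+|t'|) ≤ 1/265`: `|𝒟^F_L(β)| ≤ 6.032 e^{-L/1000}/β`
(`= 6.032 T e^{-L/1000}`; paper Thm 12 (iv): `6.04 T e^{-L/1000}`), uniformly in `U`, `μ`.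
[programme node: bounds.tex §12 Thm 12 (iv), instance `KP̄(1/265; 0.377, 10⁻³, 1/2)`,
EXTREMISERS.md §5w] -/
@[conjecture] def HighTemperatureNoTwistCurvatureTT'At265 : Prop :=
  ∀ (L : ℕ) [NeZero L], 3 ≤ L → ∀ (t' U μ β : ℝ), 0 < β → β * (1 + |t'|) ≤ 1 / 265 →
    |thermalTwistCurvature L t' U μ β| ≤ 6032 / 1000 * Real.exp (-(1 / 1000 * L)) / β

/-- **PROOF of the node `HighTemperatureNoTwistCurvatureTT'At265`** (`η = 1/2`, `a = 0.377`,
`b = 10⁻³`; `β e^{1/2}(1+|t'|) ≤ 1/160` by `exp_half_le_265`, then #181.1's `kpBarLHS_mono` and the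
kernel-certified `kpBarLHS_inst160`). [this file] -/
theorem highTemperatureNoTwistCurvatureTT'At265_holds : HighTemperatureNoTwistCurvatureTT'At265 := by
  intro L _ hL t' U μ β hβ hT
  have hy0 : 0 ≤ β * Real.exp (1 / 2) * (1 + |t'|) := by positivity
  have hy : β * Real.exp (1 / 2) * (1 + |t'|) ≤ 1 / 160 := by
    have h1 : 0 ≤ β * (1 + |t'|) := by positivity
    calc β * Real.exp (1 / 2) * (1 + |t'|) = Real.exp (1 / 2) * (β * (1 + |t'|)) := by ring
      _ ≤ 265 / 160 * (1 / 265) :=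
          mul_le_mul exp_half_le_265 hT h1 (by norm_num)
      _ = 1 / 160 := by norm_num
  have hkp : kpBarLHS (β * Real.exp (1 / 2) * (1 + |t'|)) (377 / 1000) (1 / 1000) ≤ 377 / 1000 :=
    (kpBarLHS_mono hy0 hy (by norm_num)).trans kpBarLHS_inst160
  have h := highTemperatureNoTwistCurvatureTT'_holds L hL t' U μ β (377 / 1000) (1 / 1000) (1 / 2) hβ
    (by norm_num) (by norm_num) (by norm_num) hkp
  refine h.trans (le_of_eq ?_)
  rw [show (1 / 1000 : ℝ) * L = 1 / 1000 * L from rfl]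
  field_simp
  ring

end Torus

end Summit.HubbardSuperconductivity.HubbardLadder.Bounds

end
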